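import Mathlib
import Summits.Ventures.HodgeRepro.Tier4.Target
import Summits.Ventures.HodgeRepro.Tier4.Common.TargetData
import Summits.Ventures.HodgeRepro.Tier4.Common.TargetBall
import Summits.Ventures.HodgeRepro.Tier4.Common.TargetCalculus
import Summits.Ventures.HodgeRepro.Tier4.Common.TargetJacobian
import Summits.Ventures.HodgeRepro.Tier4.Common.AutForms
import Summits.Ventures.HodgeRepro.Tier4.LitCompactness
import Summits.Ventures.HodgeRepro.Tier4.Line4.MixedTransfer
import Summits.Ventures.HodgeRepro.Tier4.Line4.Forms11
import Summits.Ventures.HodgeRepro.Tier4.Line4.MixedInvariant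
import Summits.Ventures.HodgeRepro.Tier4.Line4.PullbackWedge
import Summits.Ventures.HodgeRepro.Tier4.Line4.HoloRegularity
import Summits.Ventures.HodgeRepro.Tier4.Line4.MixedClosed
import Summits.Ventures.HodgeRepro.Tier4.Line4.ExactOnBall
import Summits.Ventures.HodgeRepro.Tier4.Line4.WirtingerChain
import Summits.Ventures.HodgeRepro.Tier4.Line3.BallChangeOfVariables
import Summits.Ventures.HodgeRepro.Tier4.Line3.DomainTransfer
import Summits.Ventures.HodgeRepro.Tier4.Line4.DomainUnfold
import Summits.Ventures.HodgeRepro.Tier4.Line4.Partition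
import Summits.Ventures.HodgeRepro.Tier4.Line4.QuotientTiling
import Summits.Ventures.HodgeRepro.Tier4.Line4.StokesQuotient

import Summits.Ventures.HodgeRepro.Tier4.Line4.Cohomology11
/-!
# Tier4/Line4/WirtingerSchwarz — Schwarz for the Wirtinger operators of a `C²` function; `(dη)^{1,1}` of a smooth pure
`1`-form is closed and `C¹` (SUPPORT for L4.0′ `pair11_descends`)

Blind re-derivation cell `pub-hodge-repro`, Tier 4 (README §9–§10), seat t4-L4-p2 (prover, LINE L4, gen 0).  Tree path
`lean/Summits/Ventures/HodgeRepro/Tier4/Line4/WirtingerSchwarz.lean`.  WHAT IS PROVED: `dz_dz_comm`, `dz_dzbar_comm`,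
`dzbar_dzbar_comm` (the mixed Wirtinger derivatives of a real-`C²` function on the ball commute — Mathlib's
`second_derivative_symmetric_of_eventually_of_real`), `contDiffOn_dz_of_contDiffOn` / `contDiffOn_dzbar_of_contDiffOn`
(`∂ g`, `∂̄ g` are `C¹` for `g` `C²`), `contDiffOn_d11_entry` and **`isClosed11_d11_of_isPure11`**: the `(1,1)`-part of
`dη` for a smooth `1`-form `η` with `(dη)^{2,0} = (dη)^{0,2} = 0` (`IsPure11`) is a closed `(1,1)`-form (`IsClosed11`) —
the step that makes the pairing of two coboundaries vanish.

Nothing here says anything about the status of the Hodge conjecture for CM abelian varieties, which is NOT proved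
(HC_CM is NOT proved by anyone in this repository).
-/

set_option autoImplicit false

noncomputable section

open Matrix MeasureTheory NumberField Topology Set
open scoped ComplexConjugate ComplexOrder

namespace Summit.Ventures.HodgeRepro.Tier4.Line4

open Summit.Ventures.HodgeRepro.Tier4 Summit.Ventures.HodgeRepro.Tier4.Line3

variable {F E : Type} [Field F] [NumberField F] [IsGalois ℚ F] [IsCMField F]
  [Field E] [NumberField E] [IsGalois ℚ E] [IsCMField E] (d : TargetData F E)

/-! ## 2. Schwarz for the Wirtinger operators of a `C²` function; `(dη)^{1,1}` of a pure `η` is closed and `C¹` -/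

section Schwarz

/-- The real second derivative of a `C²` function on the ball exists at every point of the ball. -/
theorem hasFDerivAt_fderiv_of_contDiffOn {g : (Fin 2 → ℂ) → ℂ} (hg : ContDiffOn ℝ 2 g ball) {z : Fin 2 → ℂ}
    (hz : z ∈ ball) : HasFDerivAt (fderiv ℝ g) (fderiv ℝ (fderiv ℝ g) z) z :=
  (((hg.fderiv_of_isOpen isOpen_ball (by norm_num)).differentiableOn one_ne_zero).differentiableAt
    (isOpen_ball.mem_nhds hz)).hasFDerivAt

/-- The derivative of `w ↦ fderiv ℝ g w v` in the direction `u` is the second derivative `D²g(z) u v`. -/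
theorem fderiv_fderiv_apply_real {g : (Fin 2 → ℂ) → ℂ} (hg : ContDiffOn ℝ 2 g ball) {z : Fin 2 → ℂ}
    (hz : z ∈ ball) (v u : Fin 2 → ℂ) :
    fderiv ℝ (fun w => fderiv ℝ g w v) z u = fderiv ℝ (fderiv ℝ g) z u v := by
  rw [((hasFDerivAt_fderiv_of_contDiffOn hg hz).clm_apply (hasFDerivAt_const v z)).fderiv]
  simp

/-- The second derivative of a `C²` function on the ball is symmetric. -/
theorem fderiv_fderiv_symm {g : (Fin 2 → ℂ) → ℂ} (hg : ContDiffOn ℝ 2 g ball) {z : Fin 2 → ℂ} (hz : z ∈ ball)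
    (u v : Fin 2 → ℂ) : fderiv ℝ (fderiv ℝ g) z u v = fderiv ℝ (fderiv ℝ g) z v u := by
  have hf' : ∀ᶠ y in 𝓝 z, HasFDerivAt g (fderiv ℝ g y) y := by
    filter_upwards [isOpen_ball.mem_nhds hz] with y hy
    exact (((hg.differentiableOn (by norm_num)).differentiableAt (isOpen_ball.mem_nhds hy))).hasFDerivAt
  exact second_derivative_symmetric_of_eventually_of_real hf' (hasFDerivAt_fderiv_of_contDiffOn hg hz) u v

/-- `w ↦ fderiv ℝ g w v` is ℝ-differentiable on the ball for `g` `C²` on the ball. -/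
theorem differentiableAt_fderiv_apply_real {g : (Fin 2 → ℂ) → ℂ} (hg : ContDiffOn ℝ 2 g ball) {z : Fin 2 → ℂ}
    (hz : z ∈ ball) (v : Fin 2 → ℂ) : DifferentiableAt ℝ (fun w => fderiv ℝ g w v) z :=
  ((hasFDerivAt_fderiv_of_contDiffOn hg hz).clm_apply (hasFDerivAt_const v z)).differentiableAt

/-- The derivative of `∂_a g` in the direction `u`, in terms of the second derivative. -/
theorem fderiv_dz_apply {g : (Fin 2 → ℂ) → ℂ} (hg : ContDiffOn ℝ 2 g ball) {z : Fin 2 → ℂ} (hz : z ∈ ball)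
    (a : Fin 2) (u : Fin 2 → ℂ) :
    fderiv ℝ (dz a g) z u = (1 / 2 : ℂ) * (fderiv ℝ (fderiv ℝ g) z u (Pi.single a 1) -
      Complex.I * fderiv ℝ (fderiv ℝ g) z u (Pi.single a Complex.I)) := by
  have hA : HasFDerivAt (fun w => fderiv ℝ g w (Pi.single a (1 : ℂ)))
      ((fderiv ℝ g z).comp (0 : (Fin 2 → ℂ) →L[ℝ] (Fin 2 → ℂ)) +
        (fderiv ℝ (fderiv ℝ g) z).flip (Pi.single a 1)) z :=
    (hasFDerivAt_fderiv_of_contDiffOn hg hz).clm_apply (hasFDerivAt_const _ z)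
  have hB : HasFDerivAt (fun w => fderiv ℝ g w (Pi.single a Complex.I))
      ((fderiv ℝ g z).comp (0 : (Fin 2 → ℂ) →L[ℝ] (Fin 2 → ℂ)) +
        (fderiv ℝ (fderiv ℝ g) z).flip (Pi.single a Complex.I)) z :=
    (hasFDerivAt_fderiv_of_contDiffOn hg hz).clm_apply (hasFDerivAt_const _ z)
  have h : HasFDerivAt (fun w => (1 / 2 : ℂ) * (fderiv ℝ g w (Pi.single a 1) -
      Complex.I * fderiv ℝ g w (Pi.single a Complex.I)))
      ((1 / 2 : ℂ) • (((fderiv ℝ g z).comp (0 : (Fin 2 → ℂ) →L[ℝ] (Fin 2 → ℂ)) +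
        (fderiv ℝ (fderiv ℝ g) z).flip (Pi.single a 1)) -
        Complex.I • ((fderiv ℝ g z).comp (0 : (Fin 2 → ℂ) →L[ℝ] (Fin 2 → ℂ)) +
        (fderiv ℝ (fderiv ℝ g) z).flip (Pi.single a Complex.I)))) z :=
    (hA.sub (hB.const_mul Complex.I)).const_mul (1 / 2 : ℂ)
  rw [show dz a g = fun w => (1 / 2 : ℂ) * (fderiv ℝ g w (Pi.single a 1) -
    Complex.I * fderiv ℝ g w (Pi.single a Complex.I)) from rfl, h.fderiv]
  simp

/-- The derivative of `∂̄_a g` in the direction `u`, in terms of the second derivative. -/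
theorem fderiv_dzbar_apply {g : (Fin 2 → ℂ) → ℂ} (hg : ContDiffOn ℝ 2 g ball) {z : Fin 2 → ℂ} (hz : z ∈ ball)
    (a : Fin 2) (u : Fin 2 → ℂ) :
    fderiv ℝ (dzbar a g) z u = (1 / 2 : ℂ) * (fderiv ℝ (fderiv ℝ g) z u (Pi.single a 1) +
      Complex.I * fderiv ℝ (fderiv ℝ g) z u (Pi.single a Complex.I)) := by
  have hA : HasFDerivAt (fun w => fderiv ℝ g w (Pi.single a (1 : ℂ)))
      ((fderiv ℝ g z).comp (0 : (Fin 2 → ℂ) →L[ℝ] (Fin 2 → ℂ)) +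
        (fderiv ℝ (fderiv ℝ g) z).flip (Pi.single a 1)) z :=
    (hasFDerivAt_fderiv_of_contDiffOn hg hz).clm_apply (hasFDerivAt_const _ z)
  have hB : HasFDerivAt (fun w => fderiv ℝ g w (Pi.single a Complex.I))
      ((fderiv ℝ g z).comp (0 : (Fin 2 → ℂ) →L[ℝ] (Fin 2 → ℂ)) +
        (fderiv ℝ (fderiv ℝ g) z).flip (Pi.single a Complex.I)) z :=
    (hasFDerivAt_fderiv_of_contDiffOn hg hz).clm_apply (hasFDerivAt_const _ z)
  have h : HasFDerivAt (fun w => (1 / 2 : ℂ) * (fderiv ℝ g w (Pi.single a 1) +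
      Complex.I * fderiv ℝ g w (Pi.single a Complex.I)))
      ((1 / 2 : ℂ) • (((fderiv ℝ g z).comp (0 : (Fin 2 → ℂ) →L[ℝ] (Fin 2 → ℂ)) +
        (fderiv ℝ (fderiv ℝ g) z).flip (Pi.single a 1)) +
        Complex.I • ((fderiv ℝ g z).comp (0 : (Fin 2 → ℂ) →L[ℝ] (Fin 2 → ℂ)) +
        (fderiv ℝ (fderiv ℝ g) z).flip (Pi.single a Complex.I)))) z :=
    (hA.add (hB.const_mul Complex.I)).const_mul (1 / 2 : ℂ)
  rw [show dzbar a g = fun w => (1 / 2 : ℂ) * (fderiv ℝ g w (Pi.single a 1) +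
    Complex.I * fderiv ℝ g w (Pi.single a Complex.I)) from rfl, h.fderiv]
  simp
  ring

/-- `∂_m (∂_k g) = ∂_k (∂_m g)` for `g` `C²` on the ball. -/
theorem dz_dz_comm {g : (Fin 2 → ℂ) → ℂ} (hg : ContDiffOn ℝ 2 g ball) {z : Fin 2 → ℂ} (hz : z ∈ ball)
    (m k : Fin 2) : dz m (dz k g) z = dz k (dz m g) z := by
  rw [show dz m (dz k g) z = (1 / 2 : ℂ) * (fderiv ℝ (dz k g) z (Pi.single m 1) -
    Complex.I * fderiv ℝ (dz k g) z (Pi.single m Complex.I)) from rfl,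
    show dz k (dz m g) z = (1 / 2 : ℂ) * (fderiv ℝ (dz m g) z (Pi.single k 1) -
    Complex.I * fderiv ℝ (dz m g) z (Pi.single k Complex.I)) from rfl,
    fderiv_dz_apply hg hz, fderiv_dz_apply hg hz, fderiv_dz_apply hg hz, fderiv_dz_apply hg hz,
    fderiv_fderiv_symm hg hz (Pi.single m Complex.I) (Pi.single k 1),
    fderiv_fderiv_symm hg hz (Pi.single m 1) (Pi.single k 1),
    fderiv_fderiv_symm hg hz (Pi.single m Complex.I) (Pi.single k Complex.I),
    fderiv_fderiv_symm hg hz (Pi.single m 1) (Pi.single k Complex.I)]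
  ring

/-- `∂_m (∂̄_l g) = ∂̄_l (∂_m g)` for `g` `C²` on the ball. -/
theorem dz_dzbar_comm {g : (Fin 2 → ℂ) → ℂ} (hg : ContDiffOn ℝ 2 g ball) {z : Fin 2 → ℂ} (hz : z ∈ ball)
    (m l : Fin 2) : dz m (dzbar l g) z = dzbar l (dz m g) z := by
  rw [show dz m (dzbar l g) z = (1 / 2 : ℂ) * (fderiv ℝ (dzbar l g) z (Pi.single m 1) -
    Complex.I * fderiv ℝ (dzbar l g) z (Pi.single m Complex.I)) from rfl,
    show dzbar l (dz m g) z = (1 / 2 : ℂ) * (fderiv ℝ (dz m g) z (Pi.single l 1) +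
    Complex.I * fderiv ℝ (dz m g) z (Pi.single l Complex.I)) from rfl,
    fderiv_dzbar_apply hg hz, fderiv_dzbar_apply hg hz, fderiv_dz_apply hg hz, fderiv_dz_apply hg hz,
    fderiv_fderiv_symm hg hz (Pi.single m Complex.I) (Pi.single l 1),
    fderiv_fderiv_symm hg hz (Pi.single m 1) (Pi.single l 1),
    fderiv_fderiv_symm hg hz (Pi.single m Complex.I) (Pi.single l Complex.I),
    fderiv_fderiv_symm hg hz (Pi.single m 1) (Pi.single l Complex.I)]
  ring

/-- `∂̄_m (∂̄_l g) = ∂̄_l (∂̄_m g)` for `g` `C²` on the ball. -/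
theorem dzbar_dzbar_comm {g : (Fin 2 → ℂ) → ℂ} (hg : ContDiffOn ℝ 2 g ball) {z : Fin 2 → ℂ} (hz : z ∈ ball)
    (m l : Fin 2) : dzbar m (dzbar l g) z = dzbar l (dzbar m g) z := by
  rw [show dzbar m (dzbar l g) z = (1 / 2 : ℂ) * (fderiv ℝ (dzbar l g) z (Pi.single m 1) +
    Complex.I * fderiv ℝ (dzbar l g) z (Pi.single m Complex.I)) from rfl,
    show dzbar l (dzbar m g) z = (1 / 2 : ℂ) * (fderiv ℝ (dzbar m g) z (Pi.single l 1) +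
    Complex.I * fderiv ℝ (dzbar m g) z (Pi.single l Complex.I)) from rfl,
    fderiv_dzbar_apply hg hz, fderiv_dzbar_apply hg hz, fderiv_dzbar_apply hg hz, fderiv_dzbar_apply hg hz,
    fderiv_fderiv_symm hg hz (Pi.single m Complex.I) (Pi.single l 1),
    fderiv_fderiv_symm hg hz (Pi.single m 1) (Pi.single l 1),
    fderiv_fderiv_symm hg hz (Pi.single m Complex.I) (Pi.single l Complex.I),
    fderiv_fderiv_symm hg hz (Pi.single m 1) (Pi.single l Complex.I)]
  ring

end Schwarz

/-! ## 3. `(dη)^{1,1}` of a smooth pure `η` is `C¹`, closed, and invariant when `η` is -/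

section Coboundary

/-- `∂_k g` is `C¹` on the ball for `g` `C²` on the ball. -/
theorem contDiffOn_dz_of_contDiffOn {g : (Fin 2 → ℂ) → ℂ} (hg : ContDiffOn ℝ 2 g ball) (k : Fin 2) :
    ContDiffOn ℝ 1 (dz k g) ball := by
  have h := (hg.fderiv_of_isOpen isOpen_ball (by norm_num : (1 : WithTop ℕ∞) + 1 ≤ 2))
  show ContDiffOn ℝ 1 (fun z => (1 / 2 : ℂ) * (fderiv ℝ g z (Pi.single k 1) - Complex.I * fderiv ℝ g z (Pi.single k Complex.I))) ball
  exact contDiffOn_const.mul ((h.clm_apply contDiffOn_const).sub (contDiffOn_const.mul (h.clm_apply contDiffOn_const)))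

/-- `∂̄_k g` is `C¹` on the ball for `g` `C²` on the ball. -/
theorem contDiffOn_dzbar_of_contDiffOn {g : (Fin 2 → ℂ) → ℂ} (hg : ContDiffOn ℝ 2 g ball) (k : Fin 2) :
    ContDiffOn ℝ 1 (dzbar k g) ball := by
  have h := (hg.fderiv_of_isOpen isOpen_ball (by norm_num : (1 : WithTop ℕ∞) + 1 ≤ 2))
  show ContDiffOn ℝ 1 (fun z => (1 / 2 : ℂ) * (fderiv ℝ g z (Pi.single k 1) + Complex.I * fderiv ℝ g z (Pi.single k Complex.I))) ball
  exact contDiffOn_const.mul ((h.clm_apply contDiffOn_const).add (contDiffOn_const.mul (h.clm_apply contDiffOn_const)))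

/-- `∂_k (f − g) = ∂_k f − ∂_k g` at a point of ℝ-differentiability. -/
theorem dz_sub {f g : (Fin 2 → ℂ) → ℂ} {z : Fin 2 → ℂ} (hf : DifferentiableAt ℝ f z) (hg : DifferentiableAt ℝ g z)
    (k : Fin 2) : dz k (fun w => f w - g w) z = dz k f z - dz k g z := by
  unfold dz
  rw [fderiv_fun_sub hf hg]
  simp only [_root_.sub_apply]
  ring

/-- `∂̄_k (f − g) = ∂̄_k f − ∂̄_k g` at a point of ℝ-differentiability. -/
theorem dzbar_sub {f g : (Fin 2 → ℂ) → ℂ} {z : Fin 2 → ℂ} (hf : DifferentiableAt ℝ f z) (hg : DifferentiableAt ℝ g z)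
    (k : Fin 2) : dzbar k (fun w => f w - g w) z = dzbar k f z - dzbar k g z := by
  unfold dzbar
  rw [fderiv_fun_sub hf hg]
  simp only [_root_.sub_apply]
  ring

/-- The entries of `(dη)^{1,1}` are `C¹` on the ball for a smooth `η`. -/
theorem contDiffOn_d11_entry {η : Forms1} (hη : Smooth1 η) (k l : Fin 2) :
    ContDiffOn ℝ 1 (fun z => d11 η z k l) ball := by
  show ContDiffOn ℝ 1 (fun z => dz k (fun w => (η w).2 l) z - dzbar l (fun w => (η w).1 k) z) ball
  exact (contDiffOn_dz_of_contDiffOn (hη l).2 k).sub (contDiffOn_dzbar_of_contDiffOn (hη k).1 l)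

/-- **`(dη)^{1,1}` is closed for a smooth pure `η`** (Schwarz + the purity identities). -/
theorem isClosed11_d11_of_isPure11 {η : Forms1} (hη : Smooth1 η) (hp : IsPure11 η) : IsClosed11 (d11 η) := by
  intro z hz
  have hd : ∀ (g : (Fin 2 → ℂ) → ℂ), ContDiffOn ℝ 2 g ball → ∀ k, DifferentiableAt ℝ (dz k g) z ∧
      DifferentiableAt ℝ (dzbar k g) z := fun g hg k =>
    ⟨((contDiffOn_dz_of_contDiffOn hg k).differentiableOn one_ne_zero).differentiableAt (isOpen_ball.mem_nhds hz),
     ((contDiffOn_dzbar_of_contDiffOn hg k).differentiableOn one_ne_zero).differentiableAt (isOpen_ball.mem_nhds hz)⟩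
  have e1 : ∀ m k : Fin 2, dz m (fun w => (η w).1 k) =ᶠ[𝓝 z] dz k (fun w => (η w).1 m) := by
    intro m k
    filter_upwards [isOpen_ball.mem_nhds hz] with w hw
    exact (hp w hw).1 m k
  have e2 : ∀ n l : Fin 2, dzbar n (fun w => (η w).2 l) =ᶠ[𝓝 z] dzbar l (fun w => (η w).2 n) := by
    intro n l
    filter_upwards [isOpen_ball.mem_nhds hz] with w hw
    exact (hp w hw).2 n l
  constructor
  · intro k l m
    show dz m (fun w => dz k (fun w' => (η w').2 l) w - dzbar l (fun w' => (η w').1 k) w) z =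
      dz k (fun w => dz m (fun w' => (η w').2 l) w - dzbar l (fun w' => (η w').1 m) w) z
    rw [dz_sub (hd _ (hη l).2 k).1 (hd _ (hη k).1 l).2, dz_sub (hd _ (hη l).2 m).1 (hd _ (hη m).1 l).2,
      dz_dz_comm (hη l).2 hz m k, dz_dzbar_comm (hη k).1 hz m l, dzbar_congr (e1 m k) l,
      ← dz_dzbar_comm (hη m).1 hz k l]
  · intro k l n
    show dzbar n (fun w => dz k (fun w' => (η w').2 l) w - dzbar l (fun w' => (η w').1 k) w) z =
      dzbar l (fun w => dz k (fun w' => (η w').2 n) w - dzbar n (fun w' => (η w').1 k) w) z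
    rw [dzbar_sub (hd _ (hη l).2 k).1 (hd _ (hη k).1 l).2, dzbar_sub (hd _ (hη n).2 k).1 (hd _ (hη k).1 n).2,
      ← dz_dzbar_comm (hη l).2 hz k n, dz_congr (e2 n l) k, dz_dzbar_comm (hη n).2 hz k l,
      dzbar_dzbar_comm (hη k).1 hz n l]

end Coboundary

end Summit.Ventures.HodgeRepro.Tier4.Line4

end
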